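import Mathlib
import Literature.AlgebraicGeometry.Resolution.RegularLocalRingsProofs
import Literature.RingTheory.Flat.RegularFibreFlat
import Literature.RingTheory.RegularLocalRing.SopRegular
import HarnessLib

/-!
# A regular local ring finite over a regular local ring of the same dimension is free

Topic: `Literature/RingTheory/Flat`. Matsumura, *Commutative Ring Theory*, Thm. 23.1 ("`A`
regular, `B` Cohen–Macaulay, `dim B = dim A + dim F` ⇒ `B` flat over `A`") in the finite case
with `B` regular: `flat_of_isRegular_map_of_ofList_eq_maximalIdeal` is the printed induction (slice by `x ∈ 𝔪 ∖ 𝔪²`,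
Thm. 22.3 = `flat_of_flat_quotient_of_isSMulRegular`) run along a list generating `𝔪_A` whose
image is `B`-regular; `free_of_isRegularLocalRing_of_maximalIdeal_pow_le` feeds it a regular system of parameters of
`R`, which is an `S`-regular sequence as soon as `𝔪_R S` is `𝔫`-primary and `dim S = dim R`
(Thm. 17.4 (iii), `isRegular_of_maximalIdeal_pow_le_ofList`), and concludes with "flat + finite
over local ⇒ free". The regular-fibre case of 23.1 is `RegularFibreFlat`; the general
Cohen–Macaulay case is NOT here.

References: H. Matsumura, *Commutative Ring Theory*, CUP 1986, Thms. 17.4, 22.3, 23.1.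
[Matsumura1987]
-/

namespace Literature.RingTheory.Flat

open IsLocalRing Module RingTheory.Sequence Pointwise
open Literature.AlgebraicGeometry.Resolution Literature.RingTheory.RegularLocalRing

universe u

/-- **Flatness along a regular sequence of parameters** (the induction of Matsumura Thm. 23.1):
if `A → B` is a local homomorphism of Noetherian local rings and `𝔪_A` is generated by a list
of length `n` whose image in `B` is a `B`-regular sequence, then `B` is flat over `A`.
[cite: Matsumura1987, Thm. 23.1 (proof)] -/
theorem flat_of_isRegular_map_of_ofList_eq_maximalIdeal : ∀ (n : ℕ) {A : Type u} {B : Type u} [CommRing A]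
    [CommRing B] [IsNoetherianRing A] [IsLocalRing A] [IsNoetherianRing B] [IsLocalRing B]
    [Algebra A B] [IsLocalHom (algebraMap A B)] (Q : List A), Q.length = n →
    Ideal.ofList Q = maximalIdeal A → IsRegular B (Q.map (algebraMap A B)) → Module.Flat A B := by
  intro n
  induction n with
  | zero =>
    intro A B _ _ _ _ _ _ _ _ Q hlen hQ _
    have hQnil : Q = [] := List.eq_nil_of_length_eq_zero hlen
    rw [hQnil, Ideal.ofList_nil] at hQ
    refine flat_of_injective_lTensor_maximalIdeal (B := B) (M := B) ?_
    rw [← hQ]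
    exact lTensor_subtype_bot_injective
  | succ n ih =>
    intro A B _ _ _ _ _ _ _ _ Q hlen hQ hreg
    obtain ⟨x, Q', rfl⟩ : ∃ x Q', Q = x :: Q' := by
      cases Q with
      | nil => simp at hlen
      | cons x Q' => exact ⟨x, Q', rfl⟩
    rw [List.length_cons, Nat.succ_inj] at hlen
    rw [List.map_cons, isRegular_cons_iff] at hreg
    obtain ⟨hxreg, hreg'⟩ := hreg
    set f := algebraMap A B with hf
    have hQm : ∀ q ∈ x :: Q', q ∈ maximalIdeal A := fun q hq =>
      hQ ▸ Ideal.subset_span (by simpa using hq)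
    have hxm : x ∈ maximalIdeal A := hQm x (by simp)
    set J : Ideal A := Ideal.span {x} with hJ
    set I' : Ideal B := J.map f with hI'
    have hI'span : I' = Ideal.span {f x} := by rw [hI', hJ, Ideal.map_span, Set.image_singleton]
    have hxB : f x ∈ maximalIdeal B := map_nonunit f x hxm
    have hI'le : I' ≤ maximalIdeal B := by
      rw [hI'span, Ideal.span_le, Set.singleton_subset_iff]; exact hxB
    haveI : Nontrivial (B ⧸ I') :=
      Ideal.Quotient.nontrivial_iff.mpr (ne_top_of_le_ne_top (maximalIdeal.isMaximal B).ne_top hI'le)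
    haveI : IsLocalRing (B ⧸ I') :=
      isLocalRing_quotient (ne_top_of_le_ne_top (maximalIdeal.isMaximal B).ne_top hI'le)
    have hJne : J ≠ ⊤ := fun h => (maximalIdeal.isMaximal A).ne_top
      (top_le_iff.mp (h ▸ (Ideal.span_singleton_le_iff_mem _).mpr hxm))
    haveI : Nontrivial (A ⧸ J) := Ideal.Quotient.nontrivial_iff.mpr hJne
    haveI : IsLocalRing (A ⧸ J) := isLocalRing_quotient hJne
    have hmA' : maximalIdeal (A ⧸ J) = (maximalIdeal A).map (Ideal.Quotient.mk J) :=
      maximalIdeal_quotient_eq_map J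
    have hmB' : maximalIdeal (B ⧸ I') = (maximalIdeal B).map (Ideal.Quotient.mk I') :=
      maximalIdeal_quotient_eq_map I'
    haveI : IsLocalHom (algebraMap (A ⧸ J) (B ⧸ I')) := by
      refine ⟨fun a' ha' => ?_⟩
      obtain ⟨a, rfl⟩ := Ideal.Quotient.mk_surjective a'
      by_contra hna
      have ha : a ∈ maximalIdeal A := by
        by_contra ha
        exact hna ((IsLocalRing.notMem_maximalIdeal.mp ha).map (Ideal.Quotient.mk J))
      have h1 : Ideal.Quotient.mk I' (f a) ∈ maximalIdeal (B ⧸ I') := by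
        rw [hmB']
        exact Ideal.mem_map_of_mem _ (map_nonunit f a ha)
      rw [Ideal.Quotient.algebraMap_quotient_map_quotient] at ha'
      exact ((IsLocalRing.mem_maximalIdeal _).mp h1) ha'
    -- the tail generates the maximal ideal of `A/xA`
    set Q'' : List (A ⧸ J) := Q'.map (Ideal.Quotient.mk J) with hQ''
    have hQ''len : Q''.length = n := by rw [hQ'', List.length_map, hlen]
    have hQ''span : Ideal.ofList Q'' = maximalIdeal (A ⧸ J) := by
      have h0 : (Ideal.span {x}).map (Ideal.Quotient.mk J) = ⊥ := by
        rw [Ideal.map_eq_bot_iff_le_ker, Ideal.mk_ker, hJ]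
      rw [hmA', ← hQ, Ideal.ofList_cons, Ideal.map_sup, h0, bot_sup_eq, hQ'', Ideal.map_ofList]
    -- the tail is `B/xB`-regular
    have hreg'' : IsRegular (B ⧸ I') (Q''.map (algebraMap (A ⧸ J) (B ⧸ I'))) := by
      have heq : (f x • (⊤ : Submodule B B)) = I'.restrictScalars B := by
        rw [hI'span, ← Submodule.ideal_span_singleton_smul, smul_eq_mul, Ideal.mul_top]
        rfl
      let e : QuotSMulTop (f x) B ≃ₗ[B] (B ⧸ I') := Submodule.quotEquivOfEq _ _ heq
      have h1 : IsRegular (B ⧸ I') (Q'.map f) := (e.isRegular_congr _).mp hreg'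
      have h2 : IsWeaklyRegular (B ⧸ I') ((Q'.map f).map (Ideal.Quotient.mk I')) := by
        rw [← Ideal.Quotient.algebraMap_eq]
        exact (isWeaklyRegular_map_algebraMap_iff (B ⧸ I') (B ⧸ I') _).mpr h1.toIsWeaklyRegular
      have hlist : Q''.map (algebraMap (A ⧸ J) (B ⧸ I')) =
          (Q'.map f).map (Ideal.Quotient.mk I') := by
        rw [hQ'', List.map_map, List.map_map]
        rfl
      have hmem : ∀ r ∈ (Q'.map f).map (Ideal.Quotient.mk I'), r ∈ maximalIdeal (B ⧸ I') := by
        intro r hr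
        obtain ⟨r₀, hr₀, rfl⟩ := List.mem_map.mp hr
        obtain ⟨q, hq, rfl⟩ := List.mem_map.mp hr₀
        rw [hmB']
        exact Ideal.mem_map_of_mem _ (map_nonunit f q (hQm q (List.mem_cons_of_mem x hq)))
      rw [hlist]
      exact IsRegular.of_isWeaklyRegular_of_mem_maximalIdeal (B ⧸ I') hmem h2
    haveI : Module.Flat (A ⧸ J) (B ⧸ I') := ih Q'' hQ''len hQ''span hreg''
    exact flat_of_flat_quotient_of_isSMulRegular hxm hxreg

/-- **A regular local ring finite over a regular local ring of the same dimension, with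
`𝔪_R S` primary for the maximal ideal, is free** (a regular system of parameters of `R` is an
`S`-regular sequence, Matsumura 17.4 (iii), then 23.1; flat and finite over local is free).
[cite: Matsumura1987, Thm. 23.1] -/
theorem free_of_isRegularLocalRing_of_maximalIdeal_pow_le {R S : Type u} [CommRing R] [IsRegularLocalRing R]
    [CommRing S] [IsRegularLocalRing S] [Algebra R S] [Module.Finite R S]
    [IsLocalHom (algebraMap R S)] (hdim : ringKrullDim S = ringKrullDim R)
    (hprim : ∃ N : ℕ, maximalIdeal S ^ N ≤ (maximalIdeal R).map (algebraMap R S)) :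
    Module.Free R S := by
  obtain ⟨rs, -, hspan, hlen⟩ := exists_isRegular_ofList_eq_maximalIdeal (R := R)
  obtain ⟨N, hN⟩ := hprim
  have hreg : IsRegular S (rs.map (algebraMap R S)) := by
    refine isRegular_of_maximalIdeal_pow_le_ofList (fun q hq => ?_) ?_ (N := N) ?_
    · obtain ⟨r, hr, rfl⟩ := List.mem_map.mp hq
      exact map_nonunit (algebraMap R S) r (hspan ▸ Ideal.subset_span (by simpa using hr))
    · rw [List.length_map, hlen, hdim]
    · rw [← Ideal.map_ofList, hspan]
      exact hN
  haveI : Module.Flat R S := flat_of_isRegular_map_of_ofList_eq_maximalIdeal rs.length rs rfl hspan hreg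
  exact Module.free_of_flat_of_isLocalRing

/-- **A regular local ring over a regular local ring of the same dimension, with `𝔪_R S` primary
for the maximal ideal, is flat** — the same as `free_of_isRegularLocalRing_of_maximalIdeal_pow_le`
WITHOUT the finiteness of `S` over `R` (Matsumura 23.1 for `A → B` a local homomorphism of regular
local rings with `dim B = dim A` and zero-dimensional fibre `B/𝔪_A B`: a regular system of
parameters of `R` maps to an `S`-regular sequence by 17.4 (iii), and
`flat_of_isRegular_map_of_ofList_eq_maximalIdeal` applies).  This is the form used stalkwise for a
quasi-finite morphism between regular schemes ("miracle flatness", The Stacks Project, Tag 00R4, in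
the case of a regular source). [cite: Matsumura1987, Thm. 23.1] -/
theorem flat_of_isRegularLocalRing_of_maximalIdeal_pow_le {R S : Type u} [CommRing R]
    [IsRegularLocalRing R] [CommRing S] [IsRegularLocalRing S] [Algebra R S]
    [IsLocalHom (algebraMap R S)] (hdim : ringKrullDim S = ringKrullDim R)
    (hprim : ∃ N : ℕ, maximalIdeal S ^ N ≤ (maximalIdeal R).map (algebraMap R S)) :
    Module.Flat R S := by
  obtain ⟨rs, -, hspan, hlen⟩ := exists_isRegular_ofList_eq_maximalIdeal (R := R)
  obtain ⟨N, hN⟩ := hprim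
  have hreg : IsRegular S (rs.map (algebraMap R S)) := by
    refine isRegular_of_maximalIdeal_pow_le_ofList (fun q hq => ?_) ?_ (N := N) ?_
    · obtain ⟨r, hr, rfl⟩ := List.mem_map.mp hq
      exact map_nonunit (algebraMap R S) r (hspan ▸ Ideal.subset_span (by simpa using hr))
    · rw [List.length_map, hlen, hdim]
    · rw [← Ideal.map_ofList, hspan]
      exact hN
  exact flat_of_isRegular_map_of_ofList_eq_maximalIdeal rs.length rs rfl hspan hreg

end Literature.RingTheory.Flat
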